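import Summits.QuantumFields.YangMills.Theses.ParabolicTrajectory
import Literature.Probability.LatticeModels.GibbsSpecification
import Literature.MathematicalPhysics.QuantumFieldTheory.YangMillsOS
import Mathlib.Probability.Moments.Covariance

/-!
# Route `ParabolicTrajectory`, crux `LatticeGapOnTrajectory` (stmt-QuantumFields-10523):
# vocabulary of the line `orbit-kantorovich-finite-size`

Route-posited objects (D-0016 `<Route><Crux>Defs` file) shared by the registered stubs of the skeleton
`Cruxes/LatticeGapOnTrajectory/Lines/orbit-kantorovich-finite-size.lean` (lead
`prover-line-stmt-QuantumFields-10523-0`) and by the crux file that composes them. The declarations are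
VERBATIM those of the registered skeleton (same namespace, so the registered stub signatures are unchanged);
nothing in this file is asserted: every `def … : Prop` is a statement some stub proves or consumes; the two `theorem`s
are the rate-monotonicity glue.

* §1 Cells (pure probability, `G`-blind): `CoarseIdx μ` (discrete 4-torus of cell labels), `cdist`,
  `IsCellLipBound` (multi-site Dobrushin/Föllmer Lipschitz bounds), `windowAvg`, `windowVol`, the
  Kantorovich–Rubinstein window package `IsKRWindow` (Dobrushin–Shlosman finite-size hypotheses in
  dual-Lipschitz form), the engine statement `KREngine` (proved by `stub_krFiniteSizeDecay`) and the
  window-averaging toolkit statement `SpecificationTower` (`stub_specificationTower`).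
* §2 Torus gauge theory read on cells: `IsTorusFrame` (cyclic interval partitions) and `TorusFramesExist`
  (`stub_torusFrames`), `siteCell`, `cellOf`,
  `IsInteriorSite`, `IsInteriorGauge`, `repDist`, `cellDev`, `orbitWeight` (capped gauge-orbit transport
  weight), Wilson's torus specification `torusYM`, the DLR statement `WilsonTorusDLR` (proved by
  `stub_wilsonTorusDLR`), the physics clauses `RoughCentreBound`, `OrbitKRWindowsAlong` (the line's bet,
  `stub_orbitKantorovichWindow`), and `TransferHalf` (verbatim the crux's last clause) with the registered glue lemma
  `transferHalf_anti` (the only theorems of this file: antitonicity of the OS gap and of the transfer half in the rate).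

References: Dobrushin–Shlosman 1985 (constructive criterion), Föllmer 1988 Ch. I §2, Georgii 2011 Def. 1.23 /
§8.2, Osterwalder–Seiler 1978 §2; the line card `Cruxes/LatticeGapOnTrajectory/Lines/orbit-kantorovich-finite-size.md`.
-/

set_option autoImplicit false

noncomputable section

namespace Summit.QuantumFields.YangMills.Cruxes.LatticeGapOnTrajectory.OrbitKantorovichFiniteSize

open scoped BigOperators Topology ENNReal ProbabilityTheory
open Filter MeasureTheory
open Literature.Probability.LatticeModels (Specification IsSpecification IsGibbsMeasure glueWith)
open Literature.MathematicalPhysics.QuantumFieldTheory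
open Summit.QuantumFields.YangMills.Theses.ParabolicTrajectory

/-! ## §1 Cells: a 4-d discrete torus of cell labels, cell-Lipschitz bounds, window kernels -/

section Cells

/-- **Coarse index** (cell labels): the discrete 4-torus `∏ᵢ ℤ/(μᵢ+1)` (one modulus per axis, so that
cells of different extents along different axes — asymmetric frames — are covered; `+1` keeps every factor
non-trivial so the type is finite). -/
abbrev CoarseIdx (μ : Fin 4 → ℕ) : Type := (i : Fin 4) → ZMod (μ i + 1)

/-- `ℓ^∞` distance on the coarse torus (per axis the cyclic distance `|valMinAbs (x - y)|`). -/
def cdist {μ : Fin 4 → ℕ} (x y : CoarseIdx μ) : ℕ :=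
  Finset.univ.sup fun i : Fin 4 => ((x i - y i).valMinAbs).natAbs

variable {ι V S : Type*}

/-- **Cell-Lipschitz bound** (the multi-site analogue of `DobrushinMetric.IsLipBound`, Föllmer 1988 Ch. I
(2.21)): `δ ≥ 0` and `|f σ - f τ| ≤ δ c · w c σ τ` whenever `σ, τ` agree off the cell `c`; `w c` is the
weight comparing two configurations of cell `c` (here: the capped orbit transport weight). -/
structure IsCellLipBound (cell : V → ι) (w : ι → (V → S) → (V → S) → ℝ) (f : (V → S) → ℝ)
    (δ : ι → ℝ) : Prop where
  nonneg : ∀ c, 0 ≤ δ c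
  le : ∀ (c : ι) (σ τ : V → S), (∀ v, cell v ≠ c → σ v = τ v) → |f σ - f τ| ≤ δ c * w c σ τ

variable [MeasurableSpace S]

/-- **Window averaging operator** `(γ_Λ f)(η) = ∫ f dγ_Λ(· | η)` (Föllmer's `π_V f`). -/
def windowAvg (γ : Specification V S) (Λ : Finset V) (f : (V → S) → ℝ) (η : V → S) : ℝ :=
  ∫ σ, f σ ∂(γ Λ η)

variable {μ : Fin 4 → ℕ} [Fintype V]

/-- The site set of the window of radius `n` (in cells) centred at the cell `c`. -/
def windowVol (cell : V → CoarseIdx μ) (n : ℕ) (c : CoarseIdx μ) : Finset V :=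
  Finset.univ.filter fun v => cdist c (cell v) ≤ n

/-- **Kantorovich–Rubinstein window package** = the hypotheses of the Dobrushin–Shlosman finite-size criterion in
DUAL-LIPSCHITZ (Vasserstein) form for a specification `γ` read on cells `cell : V → CoarseIdx μ`, weight `w`
bounded by `R`, window radius `n`, influence profile `k c y x ≥ 0` (window centre `c`, boundary cell `y`,
interior cell `x`):
* `w` is a bounded local weight (depends on the two configurations through cell `c` only);
* `range`: boundary cells beyond coarse distance `n+1` from the centre do not influence window-local expectations
  (finite range one cell);
* `contract` (DS85 condition `C_V`, Kantorovich form, stated dually on jointly cell-Lipschitz test functions —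
  triage r1-1 (a)/r1-2 (2): JOINT form, not marginal Lipschitz ratios): changing the boundary datum on ONE cell `y`
  outside the window moves the window-kernel expectation of a window-local `f` with cell-Lipschitz bounds `δ` by
  at most `(Σ_{x ∈ W} k c y x · δ x) · w y ω η`;
* `sum_le` (DS's `Σ_{∂V}Σ_V k ≤ γ₀|V|` in the RECEIVED form averaged over window positions, which is what the
  comparison iteration contracts in sup-norm without translation invariance and equals DS's per-window sum under
  translation covariance): for every cell `x`, `Σ_{c : x ∈ W_c} Σ_{y ∈ shell W_c} k c y x ≤ γ₀ · |{c : x ∈ W_c}|`. -/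
structure IsKRWindow (cell : V → CoarseIdx μ) (w : CoarseIdx μ → (V → S) → (V → S) → ℝ)
    (γ : Specification V S) (R : ℝ) (n : ℕ) (γ₀ : ℝ)
    (k : CoarseIdx μ → CoarseIdx μ → CoarseIdx μ → ℝ) : Prop where
  w_nonneg : ∀ c σ τ, 0 ≤ w c σ τ
  w_le : ∀ c σ τ, w c σ τ ≤ R
  w_local : ∀ (c : CoarseIdx μ) (σ σ' τ τ' : V → S), (∀ v, cell v = c → σ v = σ' v) →
    (∀ v, cell v = c → τ v = τ' v) → w c σ τ = w c σ' τ'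
  k_nonneg : ∀ c y x, 0 ≤ k c y x
  range : ∀ (c y : CoarseIdx μ), n + 1 < cdist c y → ∀ (ω η : V → S), (∀ v, cell v ≠ y → ω v = η v) →
    ∀ f : (V → S) → ℝ, Measurable f → (∃ B, ∀ σ, |f σ| ≤ B) →
      DependsOn f {v | cdist c (cell v) ≤ n} →
        windowAvg γ (windowVol cell n c) f ω = windowAvg γ (windowVol cell n c) f η
  contract : ∀ (c y : CoarseIdx μ), n < cdist c y → ∀ (ω η : V → S), (∀ v, cell v ≠ y → ω v = η v) →
    ∀ (f : (V → S) → ℝ) (δ : CoarseIdx μ → ℝ), Measurable f → (∃ B, ∀ σ, |f σ| ≤ B) →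
      DependsOn f {v | cdist c (cell v) ≤ n} → IsCellLipBound cell w f δ →
        |windowAvg γ (windowVol cell n c) f ω - windowAvg γ (windowVol cell n c) f η| ≤
          (∑ x ∈ Finset.univ.filter (fun x => cdist c x ≤ n), k c y x * δ x) * w y ω η
  sum_le : ∀ x : CoarseIdx μ,
    ∑ c ∈ Finset.univ.filter (fun c => cdist c x ≤ n),
        ∑ y ∈ Finset.univ.filter (fun y => cdist c y = n + 1), k c y x ≤
      γ₀ * (Finset.univ.filter (fun c => cdist c x ≤ n)).card

/-- **Window-averaging toolkit of a specification** (statement of `stub_specificationTower`; `G`-blind,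
provable now — the multi-site analogue of the tree's `DobrushinMetric.measurable_siteAvg`, `dependsOn_siteAvg`,
`integral_eq_of_isGibbsMeasure`): for a specification `γ` on a finite site set and a bounded measurable `f`,
the window average `γ_Λ f` is measurable, bounded by the same bound, depends only on the configuration off `Λ`
(outside-measurability), pulls out bounded measurable factors depending only on `Λᶜ` (properness), and has the
same expectation as `f` under every Gibbs measure (DLR for functions). This is exactly what the tower identity
`cov(A, B) = cov(γ_{W_A} A, γ_{W_B} B)` of `stub_smoothingToGap` consumes. -/
def SpecificationTower : Prop :=
  ∀ (V S : Type) [Fintype V] [MeasurableSpace S] (γ : Specification V S), IsSpecification γ →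
    ∀ (Λ : Finset V) (f : (V → S) → ℝ) (B : ℝ), Measurable f → (∀ σ, |f σ| ≤ B) →
      Measurable (windowAvg γ Λ f) ∧ (∀ η, |windowAvg γ Λ f η| ≤ B) ∧
      DependsOn (windowAvg γ Λ f) ((↑Λ : Set V)ᶜ) ∧
      (∀ h : (V → S) → ℝ, Measurable h → (∃ B', ∀ σ, |h σ| ≤ B') → DependsOn h ((↑Λ : Set V)ᶜ) →
        ∀ η, windowAvg γ Λ (fun σ => h σ * f σ) η = h η * windowAvg γ Λ f η) ∧
      ∀ ν : Measure (V → S), IsGibbsMeasure γ ν → ∫ η, windowAvg γ Λ f η ∂ν = ∫ σ, f σ ∂ν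

end Cells

/-- **The Dobrushin–Shlosman / Kantorovich finite-size ENGINE** (statement of `stub_krFiniteSizeDecay`): for window
radius `n`, ratio `γ₀ < 1` and weight bound `R` there are `κ > 0`, `C₀` (depending on NOTHING else) such that on
every coarse 4-torus with `≥ 2n+3` labels per axis (windows and their shells do not wrap), for every finite site
set, every specification satisfying the KR window package and EVERY Gibbs measure `ν` of it, covariances of bounded
measurable cell-local cell-Lipschitz observables decay like `C₀ (Σδ_f)(Σδ_g) e^{-κ D}` in the coarse distance `D`
between their cell supports (DobrushinShlosman1985 Thm (`C_V` ⇒ uniqueness + exponential decay; Vasserstein metric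
over a compact metric spin space); Dobrushin 1970 Thm 3–4 and Follmer1988 Ch. I (2.17)–(2.24) for the dual-Lipschitz
bookkeeping, in the tree as `DobrushinMetric.*`; Künsch CMP 84 (1982) / Georgii2011 §8.2 for the covariance step by
tilting, in the tree as `abs_covariance_le_of_isKRContraction`). -/
def KREngine : Prop :=
  ∀ (n : ℕ) (γ₀ R : ℝ), 0 ≤ γ₀ → γ₀ < 1 → 0 ≤ R → ∃ κ C₀ : ℝ, 0 < κ ∧ 0 ≤ C₀ ∧
    ∀ (μ : Fin 4 → ℕ) (V S : Type) [Fintype V] [MeasurableSpace S]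
      (cell : V → CoarseIdx μ) (w : CoarseIdx μ → (V → S) → (V → S) → ℝ)
      (γ : Specification V S) (k : CoarseIdx μ → CoarseIdx μ → CoarseIdx μ → ℝ),
      (∀ i, 2 * n + 3 ≤ μ i + 1) → IsSpecification γ → IsKRWindow cell w γ R n γ₀ k →
      ∀ ν : Measure (V → S), IsGibbsMeasure γ ν →
      ∀ (f g : (V → S) → ℝ) (Δf Δg : Finset (CoarseIdx μ)) (δf δg : CoarseIdx μ → ℝ) (D : ℕ),
        Measurable f → Measurable g → (∃ B, ∀ σ, |f σ| ≤ B) → (∃ B, ∀ σ, |g σ| ≤ B) →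
        DependsOn f {v | cell v ∈ Δf} → DependsOn g {v | cell v ∈ Δg} →
        IsCellLipBound cell w f δf → IsCellLipBound cell w g δg →
        (∀ x ∈ Δf, ∀ y ∈ Δg, D ≤ cdist x y) →
          |cov[f, g; ν]| ≤ C₀ * (∑ x ∈ Δf, δf x) * (∑ y ∈ Δg, δg y) * Real.exp (-(κ * D))

/-! ## §2 The torus gauge theory read on cells: frames, orbit weight, Wilson's torus specification -/

section Torus

variable {G : Type} [Group G] [TopologicalSpace G] [IsTopologicalGroup G] [CompactSpace G]
  [MeasurableSpace G] [BorelSpace G]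

/-- **Cyclic frame** of scale `b` on `ℤ/N`: a label map `q : ℤ/N → ℤ/m` that steps by `0` or `1` and whose fibres
are cyclic intervals of length in `[b, 2b]` (odd / prime torus sides force unequal cells — triage r1-1 (c): a
compact family of cell shapes, translation covariance lost, stated so). -/
def IsTorusFrame (N b : ℕ) {m : ℕ} (q : ZMod N → ZMod m) : Prop :=
  (∀ x : ZMod N, q (x + 1) = q x ∨ q (x + 1) = q x + 1) ∧
    ∀ c : ZMod m, ∃ (a : ZMod N) (ℓ : ℕ), b ≤ ℓ ∧ ℓ ≤ 2 * b ∧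
      ∀ x : ZMod N, q x = c ↔ ∃ j : ℕ, j < ℓ ∧ x = a + j

/-- **Torus frames exist and are coarse-Lipschitz** (statement of `stub_torusFrames`; pure `ZMod` combinatorics,
provable now). (1) For EVERY torus frame of scale `b ≥ 1` the cyclic site distance is controlled by the cyclic
label distance: `|y − x| ≤ 2b (|q y − q x| + 1)` (cells are at most `2b` long, both ways round). (2) Existence
with two prescribed short arcs: on `ℤ/N` with `(2n₀+3)·2b ≤ N`, `4w + 4 ≤ b`, for any two centres `x₁, x₂` there is
a frame of scale `b` with at least `2n₀+3` cells such that each of the arcs `xᵢ − w, …, xᵢ + w` lies inside ONE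
cell (the two arcs share a cell when they are close). Used by `stub_smoothingToGap` axis by axis (time axis: the
supports of `A` at time `0` and of `τ_m B` at time `m`; spatial axes: `x₁ = x₂ = 0`). -/
def TorusFramesExist : Prop :=
  (∀ (N b μ : ℕ) (q : ZMod N → ZMod (μ + 1)), NeZero N → 1 ≤ b → IsTorusFrame N b q →
      ∀ x y : ZMod N, ((y - x).valMinAbs).natAbs ≤ 2 * b * ((((q y - q x).valMinAbs).natAbs) + 1)) ∧
  ∀ (n₀ N b w : ℕ) (x₁ x₂ : ZMod N), NeZero N → 1 ≤ b → 4 * w + 4 ≤ b → (2 * n₀ + 3) * (2 * b) ≤ N →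
    ∃ (μ : ℕ) (q : ZMod N → ZMod (μ + 1)), 2 * n₀ + 3 ≤ μ + 1 ∧ IsTorusFrame N b q ∧
      (∀ j : ℕ, j ≤ 2 * w → q (x₁ - (w : ZMod N) + (j : ZMod N)) = q x₁) ∧
      (∀ j : ℕ, j ≤ 2 * w → q (x₂ - (w : ZMod N) + (j : ZMod N)) = q x₂)

variable {N : ℕ} {μ : Fin 4 → ℕ}

/-- Cell label of a torus site: apply the axis frames coordinatewise. -/
def siteCell (q : (i : Fin 4) → ZMod N → ZMod (μ i + 1)) (x : Site 4 N) : CoarseIdx μ :=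
  fun i => q i (x i)

/-- Cell label of a torus edge = label of its base point. -/
def cellOf (q : (i : Fin 4) → ZMod N → ZMod (μ i + 1)) (e : Edge 4 N) : CoarseIdx μ :=
  siteCell q e.1

/-- Interior site of the cell `c`: all eight incident edges (`(x, i)` and `(x - eᵢ, i)`) carry the label `c`.
Gauge transformations supported on interior sites of DISTINCT cells compose to one global gauge transformation,
and an interior site is never an endpoint of an edge of another cell. -/
def IsInteriorSite (q : (i : Fin 4) → ZMod N → ZMod (μ i + 1)) (c : CoarseIdx μ) (x : Site 4 N) : Prop :=
  siteCell q x = c ∧ ∀ i : Fin 4, siteCell q (x - Pi.single i 1) = c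

/-- Gauge transformations at the interior sites of the cell `c` (identity elsewhere). -/
def IsInteriorGauge (q : (i : Fin 4) → ZMod N → ZMod (μ i + 1)) (c : CoarseIdx μ) (g : Site 4 N → G) :
    Prop :=
  ∀ x : Site 4 N, ¬ IsInteriorSite q c x → g x = 1

/-- Entrywise deviation of two group elements in the faithful representation `r` (`≤ 2N²`; it induces the
topology of `G` since `r.ρ` is a closed embedding). -/
def repDist (r : LatticeRep G) (u v : G) : ℝ :=
  ∑ i, ∑ j, ‖r.ρ u i j - r.ρ v i j‖

/-- **Sup interior-orbit deviation** of two configurations on the cell `c`: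
`inf_{g interior gauge} sup_{e ∈ c} d_r(U_e, (U'^g)_e)`. -/
def cellDev (r : LatticeRep G) (q : (i : Fin 4) → ZMod N → ZMod (μ i + 1)) (c : CoarseIdx μ)
    (U U' : GaugeConfig 4 N G) : ℝ :=
  ⨅ g : {g : Site 4 N → G // IsInteriorGauge q c g},
    ⨆ e : {e : Edge 4 N // cellOf q e = c}, repDist r (U e.1) (gaugeTransform g.1 U' e.1)

/-- **The capped gauge-ORBIT transport weight at resolution `α`** (`cellOrbitWeight` of the idea card):
`w_c(U, U') = min(1, cellDev/α)` — bounded by `R = 1`, local in the cell, blind to interior gauge, so that every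
gauge-invariant cylinder observable is cellwise Lipschitz and `Σ_cells w` sees exactly the gauge-invariant content. -/
def orbitWeight (r : LatticeRep G) (α : ℝ) (q : (i : Fin 4) → ZMod N → ZMod (μ i + 1)) (c : CoarseIdx μ)
    (U U' : GaugeConfig 4 N G) : ℝ :=
  min 1 (cellDev r q c U U' / α)

/-- **Wilson's TORUS specification** at inverse coupling `β` on the symmetric torus `(ℤ/N)⁴` in the representation
`ρ` (the finite-volume, periodic analogue of the tree's `ymSpecification` on `ℤ⁴`): product Haar on the edges of
`Λ`, glued with the boundary condition `η` off `Λ`, tilted by `-β` times the FULL torus Wilson action (terms not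
touching `Λ` are constant in the glued variables and cancel in the normalisation). -/
def torusYM {Nr : ℕ} (ρ : G →* Matrix (Fin Nr) (Fin Nr) ℂ) (β : ℝ) (N : ℕ) [NeZero N] :
    Specification (Edge 4 N) G :=
  fun Λ η => ((Measure.pi fun _ : ↥Λ => haarProbability G).map (glueWith Λ · η)).tilted
    fun U => -β * wilsonAction ρ U

/-- **DLR description of the crux's measure** (statement of `stub_wilsonTorusDLR`): for every coupling and every
torus side, `torusYM` is a specification in Georgii's sense and the tree's `wilsonMeasure` (the measure inside
`latticeConnectedCorr`, hence inside `HasLatticeMassGap`) is a Gibbs measure for it. -/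
def WilsonTorusDLR (r : LatticeRep G) : Prop :=
  ∀ (β : ℝ) (N : ℕ) [NeZero N],
    IsSpecification (torusYM r.ρ β N) ∧
      IsGibbsMeasure (torusYM r.ρ β N) (wilsonMeasure (d := 4) (L := N) r.ρ β)

/-- **Rough-centre bound** (the second, `G`-blind physics clause — UV decoupling): on the torus of side `N` at
coupling `β`, read through the frames `q` at resolution `α` with window radius `n₀`, every bounded measurable
`f` depending on at most `s` edges of the CENTRAL cell `c` has a window average `γ_{W(c)} f` (a function of the
shell data) that is cell-Lipschitz in the ORBIT weight with bounds supported on the shell and total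
`Σ_shell δ ≤ K · ‖f‖_∞`. (Lattice-local supports only: for whole-cell rough statistics the TV influence tends to
`1` — the card's point (i) — whereas `s` links cannot resolve a physical-amplitude background response,
`a_k² ε ≪ g_k`; holds in the Coulomb phase too, carries no gap content.) -/
def RoughCentreBound (r : LatticeRep G) (β : ℝ) (N : ℕ) [NeZero N]
    (q : (i : Fin 4) → ZMod N → ZMod (μ i + 1)) (α : ℝ) (n₀ s : ℕ) (K : ℝ) : Prop :=
  ∀ (c : CoarseIdx μ) (f : GaugeConfig 4 N G → ℝ) (E : Finset (Edge 4 N)) (B : ℝ),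
    E.card ≤ s → (∀ e ∈ E, cellOf q e = c) → DependsOn f (↑E : Set (Edge 4 N)) → Measurable f →
    (∀ U, |f U| ≤ B) →
      ∃ δ : CoarseIdx μ → ℝ,
        IsCellLipBound (cellOf q) (orbitWeight r α q)
          (windowAvg (torusYM r.ρ β N) (windowVol (cellOf q) n₀ c) f) δ ∧
        (∀ y, cdist c y ≠ n₀ + 1 → δ y = 0) ∧
        ∑ y ∈ Finset.univ.filter (fun y => cdist c y = n₀ + 1), δ y ≤ K * B

/-- **Orbit–Kantorovich windows along the scheme** (statement of the physics stub, consumed by the smoothing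
stub): there are a cell scale `t ≥ 1` (crux units; `t(θ) ≍ e^{c/√θ}` on the UV branch, `O(1)` on the IR branch —
no `θ`-uniform rate, Disproof §6(i)), a window radius `n₀`, a ratio `γ₀ < 1`, a `k`-DEPENDENT resolution `α_k > 0`
(lead reshape 2, adopting drefute R1 2026-08-16: with a `k`-uniform `α` and `β_k → ∞` the Lipschitz-dual clause
`IsKRWindow.contract` is violated by O(1/β_k)-wide first-order switching of single FACE links under balanced boundary
pins — evidence `FaceMode.lean`, `FaceModeArithmetic.lean` on the crux item; physically `α_k ≍ λ/β_k`) and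
rough-centre constants `K_s` such that for every support size `s`, eventually in `k`, on EVERY torus the crux's
clause visits (`S ≥ L_k`) and for EVERY family of axis frames of scale `b_k = t·M^{n_k}` with `≥ 2n₀+3` cells per
axis, Wilson's torus specification at `β_k` satisfies the KR window package in the orbit weight (`R = 1`) AND the
rough-centre bound with constant `K_s`. -/
def OrbitKRWindowsAlong (r : LatticeRep G) (M : ℕ) (sch : SpeciesScheme (YMSpecies G)) (n : ℕ → ℕ) : Prop :=
  ∃ (t n₀ : ℕ) (γ₀ : ℝ) (α : ℕ → ℝ) (K : ℕ → ℝ), 1 ≤ t ∧ 0 ≤ γ₀ ∧ γ₀ < 1 ∧ (∀ k, 0 < α k) ∧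
    ∀ s : ℕ, ∀ᶠ k in atTop, ∀ S : ℕ, sch.L k ≤ S →
      ∀ (μ : Fin 4 → ℕ) (q : (i : Fin 4) → ZMod (2 * S + 1) → ZMod (μ i + 1)),
        (∀ i, 2 * n₀ + 3 ≤ μ i + 1) → (∀ i, IsTorusFrame (2 * S + 1) (t * M ^ n k) (q i)) →
          (∃ kp : CoarseIdx μ → CoarseIdx μ → CoarseIdx μ → ℝ,
              IsKRWindow (cellOf q) (orbitWeight r (α k) q) (torusYM r.ρ (sch.β k) (2 * S + 1)) 1 n₀ γ₀ kp) ∧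
          RoughCentreBound r (sch.β k) (2 * S + 1) q (α k) n₀ s (K s)

/-- The transfer half of the crux's conclusion at rate `Δ` (verbatim the crux's last clause; = `Disproof.TransferHalf`). -/
def TransferHalf (r : LatticeRep G) (sch : SpeciesScheme (YMSpecies G)) (Δ : ℝ) : Prop :=
  ∀ sch' : SpeciesScheme (YMSpecies G), sch'.a = sch.a → sch'.β = sch.β → sch'.L = sch.L →
    ∀ T : OSData (YMSpecies G) 4, IsYangMillsFor r sch' T → T.HasMassGap Δ

/-- The OS mass gap of a datum is antitone in the rate (Disproof §2 `osData_hasMassGap_anti`, re-proved). -/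
theorem osData_hasMassGap_anti' {ι' : Type} {d : ℕ} [NeZero d] (T : OSData ι' d) {Δ Δ' : ℝ} (hΔ' : Δ' ≤ Δ)
    (h : T.HasMassGap Δ) : T.HasMassGap Δ' := by
  intro n m k k' F G' hF hG
  obtain ⟨C, hC⟩ := h n m k k' F G' hF hG
  refine ⟨max C 0, fun t ht H hH => (hC t ht H hH).trans ?_⟩
  calc C * Real.exp (-Δ * t) ≤ max C 0 * Real.exp (-Δ * t) :=
        mul_le_mul_of_nonneg_right (le_max_left _ _) (Real.exp_pos _).le
    _ ≤ max C 0 * Real.exp (-Δ' * t) :=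
        mul_le_mul_of_nonneg_left (Real.exp_le_exp.2 (by nlinarith)) (le_max_right _ _)

/-- **The transfer half is antitone in the rate** (registered glue of the skeleton: the composition produces the
lattice half and the transfer half at independent rates and glues them at the minimum, Disproof §2 `concl_iff_split`). -/
theorem transferHalf_anti :
    ∀ (G : Type) [Group G] [TopologicalSpace G] [IsTopologicalGroup G] [CompactSpace G]
      [MeasurableSpace G] [BorelSpace G] (r : LatticeRep G) (sch : SpeciesScheme (YMSpecies G)) (Δ Δ' : ℝ),
      Δ' ≤ Δ → TransferHalf r sch Δ → TransferHalf r sch Δ' := by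
  intro G _ _ _ _ _ _ r sch Δ Δ' hΔ' h sch' ha hb hL T hT
  exact osData_hasMassGap_anti' T hΔ' (h sch' ha hb hL T hT)

end Torus

end Summit.QuantumFields.YangMills.Cruxes.LatticeGapOnTrajectory.OrbitKantorovichFiniteSize

end
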